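import Summits.Langlands.Langlands.Theorems.DyadicOddResidueSectorComplementStubEpsTransport
import Summits.Langlands.Langlands.Theorems.DyadicOddResidueSectorComplementStubEpsArtinEq
import HarnessLib

/-!
# Route IrreducibilityBySelfDuality — `ReciprocityUpToIrreducibilityR` (stmt-Langlands-17925), line `Sketch`:
# the SUPERCUSPIDAL FLOOR `stub_recGL_eq_of_isSupercuspidal` (`--supports` file; no definitions)

Two reciprocity data `Rec Rec' : ReciprocityData K` agree, at every finite place `v`, on every
SUPERCUSPIDAL class of every rank, GIVEN the tree's named fact `localLanglands_gl` (Harris–Taylor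
2001 Thm. A with Henniart's 1993 uniqueness on supercuspidals) as a hypothesis.

Proof.  The pins identify the normalising pair `(d, 𝓔)` of the two local Langlands data at `v`:
* `ReciprocityData.artin_eq` (pin `llc_isCanonical`) and `localArtinData_eq_of_artin_eq` (the
  non-`artin` fields of `LocalArtinData` are propositions) give `(Rec.llc v).artin = (Rec'.llc v).artin`
  as STRUCTURES;
* `stub_llc_eps_artin_eq` (pin `llc_eps_isCanonical`, landed) gives
  `(Rec.llc v).eps.artin = (Rec'.llc v).eps.artin`;
* the `ε`-transport `stub_isLocalLanglandsGL_of_eps_artin_eq` (landed; Deligne's uniqueness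
  `localEpsilonSystem_unique_holds`, proved) re-reads the six-clause property of `Rec'.llc v` against
  the normalising pair of `Rec.llc v` (the threaded `LocalGaloisGroup` facts are propositions, so the
  two data's copies agree definitionally);
* the uniqueness half of `localLanglands_gl` (`IsLocalLanglandsGL.unique_of_isSupercuspidal`,
  Henniart 1993 Thm. 1.1) concludes.

Standard axioms only; no `sorry`.
-/

noncomputable section

set_option linter.dupNamespace false

open scoped MatrixGroups NumberField
open IsDedekindDomain Filter
open Literature.NumberTheory.Automorphic Literature.NumberTheory.GaloisRepresentations
open Summit.Langlands

namespace Summit.Langlands.Langlands.Theorems.ReciprocityUpToIrreducibilityR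

/-- The six-clause property `IsLocalLanglandsGL` of the datum `Rec'.llc v`, re-read against the
normalising pair `((Rec.llc v).artin, (Rec.llc v).eps)` of `Rec.llc v`: the pins identify the local
Artin data (`ReciprocityData.artin_eq` + `localArtinData_eq_of_artin_eq`) and the `ε`-Artin data
(`stub_llc_eps_artin_eq`), and the `ε`-transport `stub_isLocalLanglandsGL_of_eps_artin_eq` (Deligne
1973 Thm. 4.1, uniqueness, proved in tree) applies; the threaded `LocalGaloisGroup` facts are
propositions, so the two data's copies are definitionally equal. [folklore] -/
theorem isLocalLanglandsGL_transport {K : Type} [Field K] [NumberField K]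
    (Rec Rec' : ReciprocityData K) (v : HeightOneSpectrum (𝓞 K)) :
    IsLocalLanglandsGL (v.adicCompletion K) (Rec.llc v).hmul (Rec.llc v).huniq (Rec.llc v).hn
      (Rec.llc v).hex (Rec.llc v).hns (Rec.llc v).artin (Rec.llc v).eps (Rec'.llc v).recGL := by
  refine ReciprocityRigidity.stub_isLocalLanglandsGL_of_eps_artin_eq
    (ReciprocityRigidity.stub_llc_eps_artin_eq Rec Rec' v) ?_
  rw [ReciprocityRigidity.localArtinData_eq_of_artin_eq (Rec.artin_eq Rec' v)]
  exact (Rec'.llc v).isLocalLanglands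

/-- **Stub S-F (THE SUPERCUSPIDAL FLOOR): two reciprocity data agree on every SUPERCUSPIDAL class at
every finite place**, given the named fact `localLanglands_gl` (the local Langlands correspondence
for `GL_n` with Henniart's uniqueness on supercuspidals, for every non-archimedean local field and
every normalising pair) as the hypothesis.  The pins identify the normalising pair `(d, 𝓔)` of the
two local data at `v` (`isLocalLanglandsGL_transport`), and the uniqueness half of
`localLanglands_gl` (`IsLocalLanglandsGL.unique_of_isSupercuspidal`, Henniart 1993 Thm. 1.1)
applies. [cite: Henniarts1993, Thm 1.1] -/
theorem stub_recGL_eq_of_isSupercuspidal :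
    (∀ (F : Type) [Field F] [ValuativeRel F] [TopologicalSpace F] [IsNonarchimedeanLocalField F]
      (hmul : IsFrobPow.mul (F := F)) (huniq : IsFrobPow.unique (F := F))
      (hn : absInertia_normal F) (hex : exists_isFrobPow (F := F))
      (hns : WeilGroup.exists_subgroup_le_inertia_isOpen_of_continuous (F := F))
      (d : LocalArtinData F) (𝓔 : LocalEpsilonSystem F) (hd : 𝓔.artin F = d),
      localLanglands_gl F hmul huniq hn hex hns d 𝓔 hd) →
    ∀ (K : Type) [Field K] [NumberField K] (Rec Rec' : ReciprocityData K) (v : HeightOneSpectrum (𝓞 K)) (n : ℕ)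
      (c : IrrClass (GL (Fin n) (v.adicCompletion K))), c.IsSupercuspidal →
        (Rec.llc v).recGL n c = (Rec'.llc v).recGL n c := by
  intro hS09 K _ _ Rec Rec' v n c hc
  exact IsLocalLanglandsGL.unique_of_isSupercuspidal (v.adicCompletion K) _ _ _ _ _
    (Rec.llc v).eps_artin (hS09 _ _ _ _ _ _ _ _ (Rec.llc v).eps_artin) (Rec.llc v).isLocalLanglands
    (isLocalLanglandsGL_transport Rec Rec' v) c hc

end Summit.Langlands.Langlands.Theorems.ReciprocityUpToIrreducibilityR

end
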